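import Mathlib.Analysis.Calculus.SmoothSeries
import Mathlib.Analysis.Calculus.Deriv.MeanValue
import Mathlib.Analysis.Calculus.Deriv.Pow
import Mathlib.Analysis.SpecificLimits.Normed
import Mathlib.Topology.Order.DenselyOrdered
import Literature.Analysis.FunctionSpaces.BesselJ
import HarnessLib

/-!
# Discharged facts: elementary analysis of the Bessel series `J_n`

`Literature.Analysis.FunctionSpaces.BesselJ` defines `Literature.besselJ n x = ∑' k, besselJTerm n x k`,
`besselJTerm n x k = (-1)^k / (k! (k+n)!) · (x/2)^(2k+n)` (Watson §2.1 (8); DLMF 10.2.2) and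
records its standard API as named facts. This file proves, directly from the series:

* `Literature.Analysis.FunctionSpaces.summable_besselJTerm_holds`, `Literature.Analysis.FunctionSpaces.hasSum_besselJ_holds` — the series converges
  absolutely for every real `x` (comparison with the exponential series, Watson §2.11);
* `Literature.Analysis.FunctionSpaces.hasDerivAt_besselJ` — term-wise differentiation (`hasDerivAt_tsum_of_isPreconnected`),
  hence `Literature.Analysis.FunctionSpaces.differentiable_besselJ`, `Literature.Analysis.FunctionSpaces.continuous_besselJ_holds`;
* `Literature.Analysis.FunctionSpaces.hasDerivAt_besselJ_zero_holds` — `J₀' = -J₁` (Watson §2.12 (5); DLMF 10.6.3);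
* `Literature.Analysis.FunctionSpaces.hasDerivAt_mul_besselJ_one` — `(x J₁(x))' = x J₀(x)` (Andrews–Askey–Roy (4.6.1) with
  `α = 1`; DLMF 10.6.2 with `ν = 1`: `J₁' = J₀ - J₁/x`);
* `Literature.Analysis.FunctionSpaces.sq_besselJ_zero_add_sq_besselJ_one_le_one` — the "energy" `J₀² + J₁²` is non-increasing
  on `[0, ∞)` (its derivative is `-2 J₁²/x` by the two identities above), so
  `J₀(x)² + J₁(x)² ≤ J₀(0)² + J₁(0)² = 1` (a weak form of `J₀² + 2 ∑_{n≥1} J_n² = 1`,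
  Andrews–Askey–Roy (4.9.15)); with the parity `J_n(-x) = (-1)^n J_n(x)` this gives
  `Literature.Analysis.FunctionSpaces.abs_besselJ_zero_le_one_holds` (`|J₀| ≤ 1`, DLMF 10.14.1 for `ν = 0`) and `|J₁| ≤ 1` on `ℝ`;
* `Literature.Analysis.FunctionSpaces.abs_besselJ_one_le_half_mul_abs` — `|J₁(x)| ≤ |x|/2` (DLMF 10.14.4 with `ν = 1`,
  `z = x` real), from `(x²/2 ∓ x J₁)' = x (1 ∓ J₀) ≥ 0` on `[0, ∞)`;
* `Literature.Analysis.FunctionSpaces.mul_tsum_deriv_besselJTerm_succ`, `Literature.Analysis.FunctionSpaces.mul_tsum_deriv_besselJTerm` — the derivative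
  recurrences for general order, `x J_{n+1}' = x J_n - (n+1) J_{n+1}` and
  `x J_n' = n J_n - x J_{n+1}` (Andrews–Askey–Roy §4.6, the rewritten forms of (4.6.1), (4.6.2);
  DLMF 10.6.2), by re-indexing the series; hence `Literature.Analysis.FunctionSpaces.besselJ_recurrence_holds`
  (`J_n + J_{n+2} = (2(n+1)/x) J_{n+1}`, Andrews–Askey–Roy (4.6.5); DLMF 10.6.1);
* `Literature.Analysis.FunctionSpaces.abs_besselJ_le_mul_rpow_neg_half`, `Literature.Analysis.FunctionSpaces.besselJ_isBigO_rpow_neg_half_holds` —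
  `|J_n(x)| ≤ C_n x^{-1/2}` for `x ≥ n + 1`, hence `J_n = O(x^{-1/2})` at `+∞` (the leading order
  of the Hankel expansion, Andrews–Askey–Roy (4.8.5); DLMF 10.17.3), by an elementary energy
  argument: `G_n(x) = x (x (J_n² + J_{n+1}²) - (2n+1) J_n J_{n+1}) / (x - n - 1/2)` is
  non-increasing on `(n + 1/2, ∞)` and dominates `x (J_n² + J_{n+1}²)` there.

These are the inputs for the integrability of the Lieb–Wu integrands
(`Literature.Analysis.FunctionSpaces.LiebWuIntegralsProofs`).

## References

* G. N. Watson, *A Treatise on the Theory of Bessel Functions* (2nd ed., 1944), §2.1 (8), §2.11,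
  §2.12 (5) (locators as in `Literature.Analysis.FunctionSpaces.BesselJ`).
* G. E. Andrews, R. Askey, R. Roy, *Special Functions* (Cambridge, 1999), §4.6, eqs. (4.6.1)
  `(x^α J_α)' = x^α J_{α-1}`, (4.6.2) `(x^{-α} J_α)' = -x^{-α} J_{α+1}`, (4.6.5)
  `J_{α-1} + J_{α+1} = (2α/x) J_α`; §4.8, eq. (4.8.5) (Hankel asymptotic expansion of `J_α`);
  §4.9, eq. (4.9.15) `J₀² + 2 ∑_{n≥1} J_n² = 1`.
* NIST DLMF 10.2.2 (series), 10.4.1 (parity), 10.6.1 (three-term recurrence), 10.6.2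
  (`𝒞_ν' = 𝒞_{ν-1} - (ν/z) 𝒞_ν = -𝒞_{ν+1} + (ν/z) 𝒞_ν`), 10.6.3 (`J₀' = -J₁`), 10.14.1
  (`|J_ν(x)| ≤ 1`, `ν ≥ 0`), 10.14.4 (`|J_ν(z)| ≤ |z/2|^ν e^{|Im z|} / Γ(ν+1)`, `ν ≥ -1/2`),
  10.17.3 (Hankel expansion, `J_ν(x) = O(x^{-1/2})`).
-/

noncomputable section

open scoped Topology
open Filter Set Real Nat

namespace Literature.Analysis.FunctionSpaces

/-! ## Absolute convergence of the Bessel series -/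

/-- Term bound: `|(-1)^k/(k!(k+n)!) (x/2)^(2k+n)| ≤ |x/2|^n (|x/2|²)^k / k!` (drop `(k+n)! ≥ 1`);
the right-hand side is `|x/2|^n` times the exponential series at `|x/2|²` (Watson §2.11). [folklore] -/
theorem abs_besselJTerm_le (n : ℕ) (x : ℝ) (k : ℕ) :
    |besselJTerm n x k| ≤ |x / 2| ^ n * ((|x / 2| ^ 2) ^ k / k !) := by
  have hk : (0 : ℝ) < k ! := by positivity
  have hkn : (1 : ℝ) ≤ (k + n)! := Nat.one_le_cast.mpr (Nat.factorial_pos _)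
  rw [besselJTerm, abs_mul, abs_div, abs_pow, abs_pow, abs_neg, abs_one, one_pow,
    abs_of_pos (by positivity : (0 : ℝ) < k ! * (k + n)!)]
  calc 1 / (k ! * (k + n)! : ℝ) * |x / 2| ^ (2 * k + n)
      ≤ 1 / (k ! : ℝ) * |x / 2| ^ (2 * k + n) := by
        gcongr
        exact le_mul_of_one_le_right hk.le hkn
    _ = |x / 2| ^ n * ((|x / 2| ^ 2) ^ k / k !) := by ring

/-- **Discharge of `Literature.Analysis.FunctionSpaces.summable_besselJTerm`**: the Bessel series converges absolutely for every
real `x`, by comparison with `|x/2|^n exp(|x/2|²)` (Watson §2.11). [cite: Watson1944, §2.11] -/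
theorem summable_besselJTerm_holds : summable_besselJTerm := fun n x =>
  .of_norm_bounded ((Real.summable_pow_div_factorial (|x / 2| ^ 2)).mul_left (|x / 2| ^ n))
    fun k => by simpa only [Real.norm_eq_abs] using abs_besselJTerm_le n x k

/-- **Discharge of `Literature.Analysis.FunctionSpaces.hasSum_besselJ`**: the Bessel series sums to `J_n(x)` (Watson §2.1 (8);
DLMF 10.2.2). [folklore] -/
theorem hasSum_besselJ_holds : hasSum_besselJ := fun n x =>
  (summable_besselJTerm_holds n x).hasSum

/-! ## Parity -/

/-- `J_n(-x) = (-1)^n J_n(x)` term-wise (Watson §2.1). [folklore] -/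
theorem besselJTerm_neg (n : ℕ) (x : ℝ) (k : ℕ) :
    besselJTerm n (-x) k = (-1) ^ n * besselJTerm n x k := by
  have h : (-x / 2) ^ (2 * k + n) = (-1) ^ n * (x / 2) ^ (2 * k + n) := by
    rw [neg_div, neg_pow, pow_add (-1 : ℝ), pow_mul, neg_one_sq, one_pow, one_mul]
  simp only [besselJTerm, h]
  ring

/-- Parity of the Bessel functions: `J_n(-x) = (-1)^n J_n(x)` (Watson §2.1; DLMF 10.4.1). [folklore] -/
theorem besselJ_neg (n : ℕ) (x : ℝ) : besselJ n (-x) = (-1) ^ n * besselJ n x := by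
  simp only [besselJ, besselJTerm_neg, tsum_mul_left]

/-! ## Term-wise differentiation -/

/-- Each term of the Bessel series is differentiable in `x`, with derivative
`(-1)^k/(k!(k+n)!) · (2k+n) (x/2)^(2k+n-1) / 2` (natural-number subtraction in the exponent is
harmless: for `2k+n = 0` the factor `2k+n` vanishes). [folklore] -/
theorem hasDerivAt_besselJTerm (n : ℕ) (x : ℝ) (k : ℕ) :
    HasDerivAt (fun y => besselJTerm n y k) ((-1 : ℝ) ^ k / ((k ! : ℝ) * ((k + n)! : ℝ)) *
      (((2 * k + n : ℕ) : ℝ) * (x / 2) ^ (2 * k + n - 1) * (1 / 2))) x := by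
  have h : HasDerivAt (fun y : ℝ => y / 2) (1 / 2) x := (hasDerivAt_id' x).div_const 2
  exact (h.pow (2 * k + n)).const_mul _

/-- The derivative of the `k`-th term of the Bessel series of order `n`:
`d/dx [(-1)^k/(k!(k+n)!) (x/2)^(2k+n)] = (-1)^k/(k!(k+n)!) · (2k+n) (x/2)^(2k+n-1) / 2`. [folklore] -/
theorem deriv_besselJTerm (n : ℕ) (x : ℝ) (k : ℕ) :
    deriv (fun y => besselJTerm n y k) x = (-1 : ℝ) ^ k / ((k ! : ℝ) * ((k + n)! : ℝ)) *
      (((2 * k + n : ℕ) : ℝ) * (x / 2) ^ (2 * k + n - 1) * (1 / 2)) :=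
  (hasDerivAt_besselJTerm n x k).deriv

/-- Uniform bound on the term derivatives on `|y/2| ≤ M`, `M ≥ 1`:
`|d/dy term_k(y)| ≤ M^n (M²)^k / k!` (uses `2k+n ≤ 2 (k+n)!`). [folklore] -/
theorem abs_deriv_besselJTerm_le {n k : ℕ} {y M : ℝ} (hM : 1 ≤ M) (hy : |y / 2| ≤ M) :
    |deriv (fun z => besselJTerm n z k) y| ≤ M ^ n * ((M ^ 2) ^ k / k !) := by
  have hfac : ((2 * k + n : ℕ) : ℝ) ≤ 2 * (k + n)! := by
    have : 2 * k + n ≤ 2 * (k + n)! :=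
      calc 2 * k + n ≤ 2 * (k + n) := by omega
        _ ≤ 2 * (k + n)! := Nat.mul_le_mul_left 2 (Nat.self_le_factorial _)
    exact_mod_cast this
  have hpow : |y / 2| ^ (2 * k + n - 1) ≤ M ^ (2 * k + n) :=
    calc |y / 2| ^ (2 * k + n - 1) ≤ M ^ (2 * k + n - 1) := by gcongr
      _ ≤ M ^ (2 * k + n) := pow_le_pow_right₀ hM (Nat.sub_le _ _)
  rw [deriv_besselJTerm, abs_mul, abs_div, abs_pow, abs_neg, abs_one, one_pow,
    abs_of_pos (by positivity : (0 : ℝ) < k ! * (k + n)!), abs_mul, abs_mul, abs_pow,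
    Nat.abs_cast, abs_of_pos (by norm_num : (0 : ℝ) < 1 / 2)]
  calc 1 / (k ! * (k + n)! : ℝ) * (((2 * k + n : ℕ) : ℝ) * |y / 2| ^ (2 * k + n - 1) * (1 / 2))
      ≤ 1 / (k ! * (k + n)! : ℝ) * ((2 * (k + n)! : ℝ) * M ^ (2 * k + n) * (1 / 2)) := by
        gcongr
    _ = M ^ n * ((M ^ 2) ^ k / k !) := by
        have : (0 : ℝ) < (k + n)! := by positivity
        field_simp
        ring

/-- The dominating series `∑ M^n (M²)^k / k! = M^n exp(M²)` converges. [folklore] -/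
theorem summable_derivBesselJBound (M : ℝ) (n : ℕ) :
    Summable fun k : ℕ => M ^ n * ((M ^ 2) ^ k / k !) :=
  (Real.summable_pow_div_factorial (M ^ 2)).mul_left (M ^ n)

/-- The series of term derivatives converges for every real `x`. [folklore] -/
theorem summable_deriv_besselJTerm (n : ℕ) (x : ℝ) :
    Summable fun k => deriv (fun y => besselJTerm n y k) x :=
  .of_norm_bounded (summable_derivBesselJBound (max |x / 2| 1) n) fun k => by
    rw [Real.norm_eq_abs]
    exact abs_deriv_besselJTerm_le (le_max_right _ _) (le_max_left _ _)

/-- **Term-wise differentiation of the Bessel series**: `J_n` is differentiable at every real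
`x` with derivative `∑' k, d/dx term_k(x)` (Watson §2.11: an everywhere-convergent power
series may be differentiated term by term). [cite: Watson1944, §2.11] -/
theorem hasDerivAt_besselJ (n : ℕ) (x : ℝ) :
    HasDerivAt (besselJ n) (∑' k, deriv (fun y => besselJTerm n y k) x) x := by
  set R : ℝ := |x| + 1 with hR
  have hx : x ∈ Ioo (-R) R := by
    constructor <;> [linarith [neg_abs_le x]; linarith [le_abs_self x]]
  have key := hasDerivAt_tsum_of_isPreconnected (summable_derivBesselJBound (max (R / 2) 1) n)
    isOpen_Ioo isPreconnected_Ioo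
    (fun k y _ => (hasDerivAt_besselJTerm n y k).differentiableAt.hasDerivAt)
    (fun k y hy => by
      rw [Real.norm_eq_abs]
      refine abs_deriv_besselJTerm_le (le_max_right _ _) ?_
      have h1 : |y| < R := abs_lt.mpr hy
      calc |y / 2| = |y| / 2 := by rw [abs_div, abs_two]
        _ ≤ R / 2 := by linarith
        _ ≤ max (R / 2) 1 := le_max_left _ _)
    hx (summable_besselJTerm_holds n x) hx
  exact key

/-- `J_n` is differentiable on `ℝ`. [folklore] -/
theorem differentiable_besselJ (n : ℕ) : Differentiable ℝ (besselJ n) := fun x =>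
  (hasDerivAt_besselJ n x).differentiableAt

/-- **Discharge of `Literature.Analysis.FunctionSpaces.continuous_besselJ`**: `J_n` is continuous on `ℝ` (Watson §2.11). [folklore] -/
theorem continuous_besselJ_holds : continuous_besselJ := fun n =>
  (differentiable_besselJ n).continuous

/-! ## `J₀' = -J₁` and `(x J₁)' = x J₀` -/

/-- The `0`-th term of `J₀` is constant, so its derivative vanishes. [folklore] -/
theorem deriv_besselJTerm_zero_zero (x : ℝ) : deriv (fun y => besselJTerm 0 y 0) x = 0 := by
  rw [deriv_besselJTerm]
  simp

/-- Index shift: the derivative of the `(k+1)`-st term of `J₀` is minus the `k`-th term of `J₁`. [folklore] -/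
theorem deriv_besselJTerm_zero_succ (x : ℝ) (k : ℕ) :
    deriv (fun y => besselJTerm 0 y (k + 1)) x = -besselJTerm 1 x k := by
  have h1 : 2 * (k + 1) + 0 - 1 = 2 * k + 1 := by omega
  rw [deriv_besselJTerm, besselJTerm, h1]
  have hk : (0 : ℝ) < k ! := by positivity
  simp only [add_zero, Nat.factorial_succ, Nat.cast_mul, Nat.cast_add, Nat.cast_one,
    Nat.cast_ofNat, pow_succ]
  field_simp

/-- `∑' k, d/dx term_k(J₀)(x) = -J₁(x)`. [folklore] -/
theorem tsum_deriv_besselJTerm_zero (x : ℝ) :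
    ∑' k, deriv (fun y => besselJTerm 0 y k) x = -besselJ 1 x := by
  have hs : Summable fun k => deriv (fun y => besselJTerm 0 y (k + 1)) x := by
    simp_rw [deriv_besselJTerm_zero_succ]
    exact (summable_besselJTerm_holds 1 x).neg
  rw [tsum_eq_zero_add' (f := fun k => deriv (fun y => besselJTerm 0 y k) x) hs]
  simp only [deriv_besselJTerm_zero_zero, deriv_besselJTerm_zero_succ, tsum_neg, zero_add, besselJ]

/-- **Discharge of `Literature.Analysis.FunctionSpaces.hasDerivAt_besselJ_zero`**: `J₀' = -J₁` (Watson §2.12 (5); DLMF 10.6.3;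
Andrews–Askey–Roy (4.6.2) with `α = 0`). [cite: DLMF, 10.6.3; AndrewsAskeyRoy1999, §4.6 (4.6.2)] -/
theorem hasDerivAt_besselJ_zero_holds : hasDerivAt_besselJ_zero := fun x => by
  have h := hasDerivAt_besselJ 0 x
  rwa [tsum_deriv_besselJTerm_zero] at h

/-- Term-wise form of `(x J₁)' = x J₀`:
`x · (d/dx term_k of J₁) + term_k of J₁ = x · term_k of J₀`. [folklore] -/
theorem mul_deriv_besselJTerm_one_add (x : ℝ) (k : ℕ) :
    x * deriv (fun y => besselJTerm 1 y k) x + besselJTerm 1 x k = x * besselJTerm 0 x k := by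
  have h1 : 2 * k + 1 - 1 = 2 * k := by omega
  rw [deriv_besselJTerm, besselJTerm, besselJTerm, h1]
  have hk : (0 : ℝ) < k ! := by positivity
  simp only [add_zero, Nat.factorial_succ, Nat.cast_mul, Nat.cast_add, Nat.cast_one,
    Nat.cast_ofNat, pow_succ]
  field_simp
  ring

/-- `x J₁'(x) + J₁(x) = x J₀(x)` for every real `x`, where `J₁'(x) = ∑' k, d/dx term_k(J₁)(x)`
(DLMF 10.6.2 with `ν = 1`: `J₁' = J₀ - J₁/x`; Andrews–Askey–Roy (4.6.1) with `α = 1`: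
`(x J₁)' = x J₀`, proved there by exactly this term-wise computation). [cite: DLMF, 10.6.2; AndrewsAskeyRoy1999, §4.6 (4.6.1)] -/
theorem mul_tsum_deriv_besselJTerm_one_add (x : ℝ) :
    x * (∑' k, deriv (fun y => besselJTerm 1 y k) x) + besselJ 1 x = x * besselJ 0 x := by
  rw [besselJ, besselJ, ← tsum_mul_left, ← tsum_mul_left,
    ← ((summable_deriv_besselJTerm 1 x).mul_left x).tsum_add (summable_besselJTerm_holds 1 x)]
  exact tsum_congr (mul_deriv_besselJTerm_one_add x)

/-- `(x J₁(x))' = x J₀(x)` (Andrews–Askey–Roy (4.6.1) with `α = 1`; DLMF 10.6.2 with `ν = 1`). [cite: AndrewsAskeyRoy1999, §4.6 (4.6.1); DLMF 10.6.2] -/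
theorem hasDerivAt_mul_besselJ_one (x : ℝ) :
    HasDerivAt (fun y => y * besselJ 1 y) (x * besselJ 0 x) x := by
  refine ((hasDerivAt_id' x).fun_mul (hasDerivAt_besselJ 1 x)).congr_deriv ?_
  rw [← mul_tsum_deriv_besselJTerm_one_add x]
  ring

/-! ## Bounds: `J₀² + J₁² ≤ 1`, `|J₀| ≤ 1`, `|J₁| ≤ 1`, `|J₁(x)| ≤ |x|/2` -/

/-- The energy `E = J₀² + J₁²` is non-increasing on `[0, ∞)`: by `J₀' = -J₁` (DLMF 10.6.3) and
`x J₁' + J₁ = x J₀` (DLMF 10.6.2) one has `E' = -2 J₁² / x ≤ 0` on `(0, ∞)`. [folklore] -/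
theorem antitoneOn_sq_besselJ_zero_add_sq_besselJ_one :
    AntitoneOn (fun x => besselJ 0 x ^ 2 + besselJ 1 x ^ 2) (Ici 0) := by
  refine antitoneOn_of_hasDerivWithinAt_nonpos (convex_Ici 0)
    (f' := fun x => -(2 * besselJ 1 x ^ 2 / x)) ?_ ?_ ?_
  · exact (((continuous_besselJ_holds 0).pow 2).add ((continuous_besselJ_holds 1).pow 2)).continuousOn
  · intro x hx
    rw [interior_Ici] at hx
    have hx' : (0 : ℝ) < x := hx
    have hid := mul_tsum_deriv_besselJTerm_one_add x
    have hD' : ∑' k, deriv (fun y => besselJTerm 1 y k) x = besselJ 0 x - besselJ 1 x / x := by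
      field_simp
      linear_combination hid
    refine ((((hasDerivAt_besselJ_zero_holds x).fun_pow 2).fun_add
        ((hasDerivAt_besselJ 1 x).fun_pow 2)).congr_deriv ?_).hasDerivWithinAt
    rw [hD']
    norm_num
    field_simp
    ring
  · intro x hx
    rw [interior_Ici] at hx
    have hx' : (0 : ℝ) < x := hx
    have : 0 ≤ 2 * besselJ 1 x ^ 2 / x := by positivity
    linarith

/-- `J₀(x)² + J₁(x)² ≤ 1` for `x ≥ 0` (the energy at `0` is `J₀(0)² + J₁(0)² = 1`). [folklore] -/
theorem sq_besselJ_zero_add_sq_besselJ_one_le_one_of_nonneg {x : ℝ} (hx : 0 ≤ x) :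
    besselJ 0 x ^ 2 + besselJ 1 x ^ 2 ≤ 1 := by
  have h := antitoneOn_sq_besselJ_zero_add_sq_besselJ_one (self_mem_Ici) hx hx
  simpa [besselJ_zero_zero, besselJ_succ_apply_zero] using h

/-- `J₀(x)² + J₁(x)² ≤ 1` for every real `x` (parity extends the bound from `[0, ∞)`); a weak
form of `J₀² + 2 ∑_{n≥1} J_n² = 1` (Andrews–Askey–Roy (4.9.15)). [cite: AndrewsAskeyRoy1999, §4.9 (4.9.15)] -/
theorem sq_besselJ_zero_add_sq_besselJ_one_le_one (x : ℝ) :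
    besselJ 0 x ^ 2 + besselJ 1 x ^ 2 ≤ 1 := by
  rcases le_or_gt 0 x with hx | hx
  · exact sq_besselJ_zero_add_sq_besselJ_one_le_one_of_nonneg hx
  · have h := sq_besselJ_zero_add_sq_besselJ_one_le_one_of_nonneg (neg_pos.mpr hx).le
    rw [besselJ_neg, besselJ_neg] at h
    simpa using h

/-- **Discharge of `Literature.Analysis.FunctionSpaces.abs_besselJ_zero_le_one`**: `|J₀(x)| ≤ 1` for all real `x`
(DLMF 10.14.1). [cite: DLMF, 10.14.1] -/
theorem abs_besselJ_zero_le_one_holds : abs_besselJ_zero_le_one := fun x => by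
  rw [← sq_le_one_iff_abs_le_one]
  nlinarith [sq_besselJ_zero_add_sq_besselJ_one_le_one x, sq_nonneg (besselJ 1 x)]

/-- `|J₁(x)| ≤ 1` for all real `x` (DLMF 10.14.1, weakened from `1/√2`). [cite: DLMF, 10.14.1] -/
theorem abs_besselJ_one_le_one (x : ℝ) : |besselJ 1 x| ≤ 1 := by
  rw [← sq_le_one_iff_abs_le_one]
  nlinarith [sq_besselJ_zero_add_sq_besselJ_one_le_one x, sq_nonneg (besselJ 0 x)]

/-- `|J₁(x)| ≤ x/2` for `x ≥ 0`: the functions `x²/2 ∓ x J₁(x)` vanish at `0` and have derivative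
`x (1 ∓ J₀(x)) ≥ 0` (DLMF 10.14.4 with `ν = 1`: `|J₁(x)| ≤ |x|/2`). [cite: DLMF, 10.14.4] -/
theorem abs_besselJ_one_le_half_mul {x : ℝ} (hx : 0 ≤ x) : |besselJ 1 x| ≤ x / 2 := by
  have hJ0 : ∀ y : ℝ, -1 ≤ besselJ 0 y ∧ besselJ 0 y ≤ 1 := fun y =>
    abs_le.mp (abs_besselJ_zero_le_one_holds y)
  have hcont : ∀ s : ℝ, ContinuousOn (fun y => y * y / 2 + s * (y * besselJ 1 y)) (Ici 0) :=
    fun s => (((continuous_id.mul continuous_id).div_const 2).add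
      (continuous_const.mul (continuous_id.mul (continuous_besselJ_holds 1)))).continuousOn
  have hderiv : ∀ s y : ℝ, HasDerivAt (fun y => y * y / 2 + s * (y * besselJ 1 y))
      (y * (1 + s * besselJ 0 y)) y := fun s y => by
    refine ((((hasDerivAt_id' y).fun_mul (hasDerivAt_id' y)).div_const 2).fun_add
      ((hasDerivAt_mul_besselJ_one y).const_mul s)).congr_deriv ?_
    ring
  have hmono : ∀ s : ℝ, |s| ≤ 1 →
      MonotoneOn (fun y => y * y / 2 + s * (y * besselJ 1 y)) (Ici 0) := fun s hs => by
    refine monotoneOn_of_hasDerivWithinAt_nonneg (convex_Ici 0) (hcont s)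
      (fun y _ => (hderiv s y).hasDerivWithinAt) ?_
    intro y hy
    rw [interior_Ici] at hy
    have hy' : (0 : ℝ) < y := hy
    refine mul_nonneg hy'.le ?_
    have h1 : |s * besselJ 0 y| ≤ 1 := by
      rw [abs_mul]
      exact mul_le_one₀ hs (abs_nonneg _) (abs_besselJ_zero_le_one_holds y)
    linarith [(abs_le.mp h1).1]
  have hF := hmono (-1) (by norm_num) (self_mem_Ici) hx hx
  have hG := hmono 1 (by norm_num) (self_mem_Ici) hx hx
  simp only [mul_zero, zero_div, neg_mul, one_mul] at hF hG
  rcases hx.eq_or_lt with h0 | hx'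
  · subst h0
    simp [besselJ_succ_apply_zero]
  · rw [abs_le]
    constructor
    · have h2 : x * (-(x / 2)) ≤ x * besselJ 1 x := by nlinarith
      exact le_of_mul_le_mul_left h2 hx'
    · have h2 : x * besselJ 1 x ≤ x * (x / 2) := by nlinarith
      exact le_of_mul_le_mul_left h2 hx'

/-- `|J₁(x)| ≤ |x|/2` for every real `x` (DLMF 10.14.4 with `ν = 1`). [cite: DLMF, 10.14.4] -/
theorem abs_besselJ_one_le_half_mul_abs (x : ℝ) : |besselJ 1 x| ≤ |x| / 2 := by
  rcases le_or_gt 0 x with hx | hx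
  · rw [abs_of_nonneg hx]
    exact abs_besselJ_one_le_half_mul hx
  · have h := abs_besselJ_one_le_half_mul (neg_pos.mpr hx).le
    rw [besselJ_neg, pow_one, neg_one_mul, abs_neg] at h
    rwa [abs_of_neg hx]

/-! ## The derivative recurrences for general order (Andrews–Askey–Roy (4.6.1), (4.6.2); DLMF 10.6.2) -/

/-- Term-wise Euler identity: `x · d/dx T_k(x) = (2k+n) T_k(x)` for the `k`-th term
`T_k(x) = (-1)^k/(k!(k+n)!) (x/2)^(2k+n)` of the series of `J_n` (it is a monomial of degree
`2k+n`). [folklore] -/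
theorem mul_deriv_besselJTerm (n : ℕ) (x : ℝ) (k : ℕ) :
    x * deriv (fun y => besselJTerm n y k) x = ((2 * k + n : ℕ) : ℝ) * besselJTerm n x k := by
  rw [deriv_besselJTerm]
  rcases Nat.eq_zero_or_pos (2 * k + n) with h | h
  · simp [h]
  · obtain ⟨m, hm⟩ : ∃ m, 2 * k + n = m + 1 := ⟨2 * k + n - 1, (Nat.succ_pred_eq_of_pos h).symm⟩
    simp only [besselJTerm, hm, Nat.add_sub_cancel, pow_succ]
    ring

/-- Index shift behind `x J_{n+1}' + (n+1) J_{n+1} = x J_n` (Andrews–Askey–Roy (4.6.1)):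
`2 (k+n+1) T^{(n+1)}_k(x) = x T^{(n)}_k(x)`. [folklore] -/
theorem besselJTerm_succ_left (n : ℕ) (x : ℝ) (k : ℕ) :
    2 * ((k : ℝ) + n + 1) * besselJTerm (n + 1) x k = x * besselJTerm n x k := by
  have hf : ((k + (n + 1))! : ℝ) = ((k : ℝ) + n + 1) * (k + n)! := by
    rw [← add_assoc, Nat.factorial_succ]; push_cast; ring
  have hp : (x / 2) ^ (2 * k + (n + 1)) = (x / 2) ^ (2 * k + n) * (x / 2) := by
    rw [← add_assoc, pow_succ]
  simp only [besselJTerm, hf, hp]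
  have h0 : ((k : ℝ) + n + 1) ≠ 0 := by positivity
  have hk : (0 : ℝ) < k ! := by positivity
  have hkn : (0 : ℝ) < (k + n)! := by positivity
  field_simp

/-- Index shift behind `x J_n' - n J_n = -x J_{n+1}` (Andrews–Askey–Roy (4.6.2)):
`2 (k+1) T^{(n)}_{k+1}(x) = -x T^{(n+1)}_k(x)`. [folklore] -/
theorem besselJTerm_succ_right (n : ℕ) (x : ℝ) (k : ℕ) :
    2 * ((k : ℝ) + 1) * besselJTerm n x (k + 1) = -(x * besselJTerm (n + 1) x k) := by
  have hf1 : ((k + 1)! : ℝ) = ((k : ℝ) + 1) * k ! := by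
    rw [Nat.factorial_succ]; push_cast; ring
  have hf2 : (k + 1 + n)! = (k + (n + 1))! := by
    rw [Nat.add_right_comm, Nat.add_assoc]
  have hp : (x / 2) ^ (2 * (k + 1) + n) = (x / 2) ^ (2 * k + (n + 1)) * (x / 2) := by
    rw [← pow_succ]; congr 1; ring
  simp only [besselJTerm, hf1, hf2, hp, pow_succ]
  have h0 : ((k : ℝ) + 1) ≠ 0 := by positivity
  have hk : (0 : ℝ) < k ! := by positivity
  have hkn : (0 : ℝ) < (k + (n + 1))! := by positivity
  field_simp

/-- **Derivative recurrence** `x J_{n+1}'(x) = x J_n(x) - (n+1) J_{n+1}(x)` for every real `x`, where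
`J_{n+1}'(x) = ∑' k, d/dx term_k(J_{n+1})(x)` is the series derivative of `hasDerivAt_besselJ`
(Andrews–Askey–Roy §4.6, rewritten form of (4.6.1) with `α = n + 1`:
`α J_α + x J_α' = x J_{α-1}`; DLMF 10.6.2). [cite: AndrewsAskeyRoy1999, §4.6 (4.6.1)] -/
theorem mul_tsum_deriv_besselJTerm_succ (n : ℕ) (x : ℝ) :
    x * (∑' k, deriv (fun y => besselJTerm (n + 1) y k) x) =
      x * besselJ n x - (n + 1) * besselJ (n + 1) x := by
  have h1 : HasSum (fun k => x * deriv (fun y => besselJTerm (n + 1) y k) x)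
      (x * ∑' k, deriv (fun y => besselJTerm (n + 1) y k) x) :=
    (summable_deriv_besselJTerm (n + 1) x).hasSum.mul_left x
  have h2 : HasSum (fun k => ((n : ℝ) + 1) * besselJTerm (n + 1) x k)
      (((n : ℝ) + 1) * besselJ (n + 1) x) := (hasSum_besselJ_holds _ _).mul_left _
  have h3 : HasSum (fun k => x * besselJTerm n x k) (x * besselJ n x) :=
    (hasSum_besselJ_holds _ _).mul_left _
  have h4 : (fun k => x * deriv (fun y => besselJTerm (n + 1) y k) x +
      ((n : ℝ) + 1) * besselJTerm (n + 1) x k) = fun k => x * besselJTerm n x k := by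
    funext k
    rw [mul_deriv_besselJTerm, ← besselJTerm_succ_left]
    push_cast
    ring
  have h5 := h1.add h2
  rw [h4] at h5
  linarith [h5.unique h3]

/-- **Derivative recurrence** `x J_n'(x) = n J_n(x) - x J_{n+1}(x)` for every real `x`, where
`J_n'(x) = ∑' k, d/dx term_k(J_n)(x)` is the series derivative of `hasDerivAt_besselJ`
(Andrews–Askey–Roy §4.6, rewritten form of (4.6.2) with `α = n`:
`-α J_α + x J_α' = -x J_{α+1}`; DLMF 10.6.2). [cite: AndrewsAskeyRoy1999, §4.6 (4.6.2)] -/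
theorem mul_tsum_deriv_besselJTerm (n : ℕ) (x : ℝ) :
    x * (∑' k, deriv (fun y => besselJTerm n y k) x) = n * besselJ n x - x * besselJ (n + 1) x := by
  set f : ℕ → ℝ := fun k => x * deriv (fun y => besselJTerm n y k) x - n * besselJTerm n x k with hf
  have h1 : HasSum f (x * (∑' k, deriv (fun y => besselJTerm n y k) x) - n * besselJ n x) :=
    ((summable_deriv_besselJTerm n x).hasSum.mul_left x).sub ((hasSum_besselJ_holds _ _).mul_left _)
  have hf0 : f 0 = 0 := by
    simp only [hf, mul_deriv_besselJTerm]; push_cast; ring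
  have hfs : ∀ k, f (k + 1) = -(x * besselJTerm (n + 1) x k) := by
    intro k
    simp only [hf]
    rw [mul_deriv_besselJTerm, ← besselJTerm_succ_right]
    push_cast
    ring
  have h2 : HasSum (fun k => f (k + 1)) (-(x * besselJ (n + 1) x)) := by
    simp_rw [hfs]
    exact ((hasSum_besselJ_holds _ _).mul_left x).neg
  have h3 : HasSum f (-(x * besselJ (n + 1) x)) := by
    refine (hasSum_nat_add_iff' 1).mp ?_
    simpa [hf0] using h2
  linarith [h1.unique h3]

/-- `J_n'(x) = (n J_n(x) - x J_{n+1}(x)) / x` for `x ≠ 0` (Andrews–Askey–Roy (4.6.2);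
DLMF 10.6.2). [cite: AndrewsAskeyRoy1999, §4.6 (4.6.2)] -/
theorem hasDerivAt_besselJ_of_ne_zero (n : ℕ) {x : ℝ} (hx : x ≠ 0) :
    HasDerivAt (besselJ n) ((n * besselJ n x - x * besselJ (n + 1) x) / x) x := by
  refine (hasDerivAt_besselJ n x).congr_deriv ?_
  rw [← mul_tsum_deriv_besselJTerm, mul_div_cancel_left₀ _ hx]

/-- `J_{n+1}'(x) = (x J_n(x) - (n+1) J_{n+1}(x)) / x` for `x ≠ 0` (Andrews–Askey–Roy (4.6.1);
DLMF 10.6.2). [cite: AndrewsAskeyRoy1999, §4.6 (4.6.1)] -/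
theorem hasDerivAt_besselJ_succ_of_ne_zero (n : ℕ) {x : ℝ} (hx : x ≠ 0) :
    HasDerivAt (besselJ (n + 1)) ((x * besselJ n x - (n + 1) * besselJ (n + 1) x) / x) x := by
  refine (hasDerivAt_besselJ (n + 1) x).congr_deriv ?_
  rw [← mul_tsum_deriv_besselJTerm_succ, mul_div_cancel_left₀ _ hx]

/-- **Discharge of `Literature.Analysis.FunctionSpaces.besselJ_recurrence`**: the three-term recurrence
`J_n(x) + J_{n+2}(x) = (2(n+1)/x) J_{n+1}(x)` for `x ≠ 0`, by eliminating `J_{n+1}'` between the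
two derivative recurrences (Andrews–Askey–Roy (4.6.5) with `α = n + 1`; Watson §2.12 (1);
DLMF 10.6.1). [cite: AndrewsAskeyRoy1999, §4.6 (4.6.5)] -/
theorem besselJ_recurrence_holds : besselJ_recurrence := by
  intro n x hx
  have h1 := mul_tsum_deriv_besselJTerm_succ n x
  have h2 := mul_tsum_deriv_besselJTerm (n + 1) x
  push_cast at h2
  rw [div_mul_eq_mul_div, eq_div_iff hx]
  linarith

/-! ## Decay `J_n(x) = O(x^{-1/2})` by an energy argument

With `p = J_n`, `q = J_{n+1}` and `c = n + 1/2` the recurrences read `x p' = (c - 1/2) p - x q`,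
`x q' = x p - (c + 1/2) q`, and the "energy" `G(x) = x (x (p² + q²) - 2c p q) / (x - c)` satisfies
`G'(x) = -c x (p - q)² / (x - c)² ≤ 0` and `G(x) - x (p² + q²) = c x (p - q)² / (x - c) ≥ 0` for
`x > c`. Hence `x J_n(x)² ≤ G(x) ≤ G(n+1)` for `x ≥ n + 1`, an explicit form of
`J_n(x) = O(x^{-1/2})` (the leading order of the Hankel expansion, Andrews–Askey–Roy (4.8.5);
DLMF 10.17.3; Watson §7.21). -/

/-- Derivative of the energy `G_n(x) = x (x (J_n² + J_{n+1}²) - (2n+1) J_n J_{n+1}) / (x - (n + 1/2))`: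
`G_n'(x) = -(n + 1/2) x (J_n(x) - J_{n+1}(x))² / (x - (n + 1/2))²` for `x > n + 1/2`, from the
derivative recurrences (Andrews–Askey–Roy (4.6.1), (4.6.2)). [folklore] -/
theorem hasDerivAt_besselJ_energy (n : ℕ) {x : ℝ} (hx : (n : ℝ) + 1 / 2 < x) :
    HasDerivAt (fun y : ℝ => y * (y * (besselJ n y ^ 2 + besselJ (n + 1) y ^ 2) -
        (2 * n + 1) * besselJ n y * besselJ (n + 1) y) / (y - (n + 1 / 2)))
      (-((n + 1 / 2) * x * (besselJ n x - besselJ (n + 1) x) ^ 2 / (x - (n + 1 / 2)) ^ 2)) x := by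
  have hx0 : x ≠ 0 := by
    have : (0 : ℝ) < x := by linarith [(n.cast_nonneg : (0 : ℝ) ≤ n)]
    exact this.ne'
  have hxc : x - (n + 1 / 2) ≠ 0 := sub_ne_zero.mpr hx.ne'
  have hp := hasDerivAt_besselJ_of_ne_zero n hx0
  have hq := hasDerivAt_besselJ_succ_of_ne_zero n hx0
  have hN := (hasDerivAt_id x).fun_mul
    ((((hasDerivAt_id x).fun_mul ((hp.fun_pow 2).fun_add (hq.fun_pow 2))).fun_sub
      ((hp.const_mul (2 * (n : ℝ) + 1)).fun_mul hq)))
  have hD : HasDerivAt (fun y : ℝ => y - ((n : ℝ) + 1 / 2)) 1 x := (hasDerivAt_id x).sub_const _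
  have hG : HasDerivAt (fun y : ℝ => y * (y * (besselJ n y ^ 2 + besselJ (n + 1) y ^ 2) -
      (2 * n + 1) * besselJ n y * besselJ (n + 1) y) / (y - (n + 1 / 2))) _ x := hN.fun_div hD hxc
  refine hG.congr_deriv ?_
  simp only [id, Nat.cast_ofNat, Nat.reduceSub, pow_one]
  field_simp
  ring

/-- The energy `G_n` is non-increasing on `(n + 1/2, ∞)` (its derivative is `≤ 0` there). [folklore] -/
theorem antitoneOn_besselJ_energy (n : ℕ) :
    AntitoneOn (fun y : ℝ => y * (y * (besselJ n y ^ 2 + besselJ (n + 1) y ^ 2) -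
        (2 * n + 1) * besselJ n y * besselJ (n + 1) y) / (y - (n + 1 / 2))) (Ioi ((n : ℝ) + 1 / 2)) := by
  refine antitoneOn_of_deriv_nonpos (convex_Ioi _) (fun x hx => ?_) (fun x hx => ?_) (fun x hx => ?_)
  · exact (hasDerivAt_besselJ_energy n hx).continuousAt.continuousWithinAt
  · rw [interior_Ioi] at hx
    exact (hasDerivAt_besselJ_energy n hx).differentiableAt.differentiableWithinAt
  · rw [interior_Ioi] at hx
    rw [(hasDerivAt_besselJ_energy n hx).deriv]
    have hx0 : 0 ≤ x := by linarith [(n.cast_nonneg : (0 : ℝ) ≤ n), mem_Ioi.mp hx]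
    have hc : (0 : ℝ) ≤ n + 1 / 2 := by positivity
    have : 0 ≤ (n + 1 / 2) * x * (besselJ n x - besselJ (n + 1) x) ^ 2 / (x - (n + 1 / 2)) ^ 2 :=
      div_nonneg (mul_nonneg (mul_nonneg hc hx0) (sq_nonneg _)) (sq_nonneg _)
    linarith

/-- The energy dominates `x (J_n² + J_{n+1}²)` on `(n + 1/2, ∞)`:
`G_n(x) - x (J_n² + J_{n+1}²) = (n + 1/2) x (J_n - J_{n+1})² / (x - (n + 1/2)) ≥ 0`. [folklore] -/
theorem mul_sq_add_sq_le_besselJ_energy (n : ℕ) {x : ℝ} (hx : (n : ℝ) + 1 / 2 < x) :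
    x * (besselJ n x ^ 2 + besselJ (n + 1) x ^ 2) ≤
      x * (x * (besselJ n x ^ 2 + besselJ (n + 1) x ^ 2) -
        (2 * n + 1) * besselJ n x * besselJ (n + 1) x) / (x - (n + 1 / 2)) := by
  have hxc : 0 < x - (n + 1 / 2) := sub_pos.mpr hx
  have hx0 : 0 < x := by linarith [(n.cast_nonneg : (0 : ℝ) ≤ n)]
  have hc : (0 : ℝ) ≤ n + 1 / 2 := by positivity
  rw [le_div_iff₀ hxc]
  nlinarith [mul_nonneg (mul_nonneg hc hx0.le) (sq_nonneg (besselJ n x - besselJ (n + 1) x))]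

/-- **Uniform decay bound**: there is `C` (namely `√(G_n(n+1))`) with `|J_n(x)| ≤ C x^{-1/2}` for all
`x ≥ n + 1` — an explicit-range form of `J_n(x) = O(x^{-1/2})` (leading order of the Hankel
expansion, Andrews–Askey–Roy (4.8.5); DLMF 10.17.3), obtained here from
`x J_n(x)² ≤ x (J_n² + J_{n+1}²) ≤ G_n(x) ≤ G_n(n+1)`. [cite: AndrewsAskeyRoy1999, §4.8 (4.8.5)] -/
theorem abs_besselJ_le_mul_rpow_neg_half (n : ℕ) :
    ∃ C : ℝ, ∀ x : ℝ, (n : ℝ) + 1 ≤ x → |besselJ n x| ≤ C * x ^ (-(1 / 2 : ℝ)) := by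
  set G : ℝ → ℝ := fun y : ℝ => y * (y * (besselJ n y ^ 2 + besselJ (n + 1) y ^ 2) -
        (2 * n + 1) * besselJ n y * besselJ (n + 1) y) / (y - (n + 1 / 2)) with hG
  set K : ℝ := G (n + 1) with hK
  refine ⟨Real.sqrt K, fun x hx => ?_⟩
  have hc : (n : ℝ) + 1 / 2 < n + 1 := by linarith
  have hx' : (n : ℝ) + 1 / 2 < x := by linarith
  have hx0 : 0 < x := by linarith [(n.cast_nonneg : (0 : ℝ) ≤ n)]
  have h1 : x * besselJ n x ^ 2 ≤ K :=
    calc x * besselJ n x ^ 2 ≤ x * (besselJ n x ^ 2 + besselJ (n + 1) x ^ 2) := by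
          nlinarith [sq_nonneg (besselJ (n + 1) x)]
      _ ≤ G x := mul_sq_add_sq_le_besselJ_energy n hx'
      _ ≤ K := antitoneOn_besselJ_energy n (mem_Ioi.mpr hc) (mem_Ioi.mpr hx') hx
  have hK0 : 0 ≤ K := le_trans (by positivity) h1
  have h2 : besselJ n x ^ 2 ≤ K * x⁻¹ := by
    rw [← div_eq_mul_inv, le_div_iff₀ hx0]; linarith
  calc |besselJ n x| ≤ Real.sqrt (K * x⁻¹) := Real.abs_le_sqrt h2
    _ = Real.sqrt K * Real.sqrt x⁻¹ := Real.sqrt_mul hK0 _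
    _ = Real.sqrt K * x ^ (-(1 / 2 : ℝ)) := by
        rw [Real.sqrt_eq_rpow x⁻¹, Real.inv_rpow hx0.le, ← Real.rpow_neg hx0.le]

/-- **Discharge of `Literature.Analysis.FunctionSpaces.besselJ_isBigO_rpow_neg_half`**: `J_n(x) = O(x^{-1/2})` as `x → +∞`
(leading order of the Hankel asymptotic expansion: Andrews–Askey–Roy (4.8.5); Watson §7.21;
DLMF 10.17.3), here from the elementary energy bound `abs_besselJ_le_mul_rpow_neg_half`. [cite: AndrewsAskeyRoy1999, §4.8 (4.8.5)] -/
theorem besselJ_isBigO_rpow_neg_half_holds : besselJ_isBigO_rpow_neg_half := by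
  intro n
  obtain ⟨C, hC⟩ := abs_besselJ_le_mul_rpow_neg_half n
  refine Asymptotics.IsBigO.of_bound C ?_
  filter_upwards [eventually_ge_atTop ((n : ℝ) + 1)] with x hx
  have hx0 : 0 ≤ x := by linarith [(n.cast_nonneg : (0 : ℝ) ≤ n)]
  rw [Real.norm_eq_abs, Real.norm_eq_abs, abs_of_nonneg (Real.rpow_nonneg hx0 _)]
  exact hC x hx

end Literature.Analysis.FunctionSpaces
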